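import Literature.NumberTheory.LFunctions.Zhang2022.Section5PrimeSums
import Literature.NumberTheory.LFunctions.Zhang2022.Section2FrakP
import HarnessLib

/-!
# Zhang (2022) Lemma 5.6 in its printed form: `∑_{p∼P} θ(p) p^{1+it} ≪ 𝔓 exp(−𝓛^{9/2})`

Trunk T-ANT (NumberTheory/LFunctions). Y. Zhang, *Discrete mean estimates and the Landau–Siegel
zero*, arXiv:2211.02515v1 (2022) [Zhang2022LandauSiegel], Lemma 5.6 [p. 11]:

> **Lemma 5.6.** For any primitive character `θ (mod r)` with `r < T` and `θ ≠ χ`,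
> `∑_{p∼P} θ(p) p^{1+it} ≪ 𝔓 exp{−𝓛^{9/2}}`  if `|t| ≤ D`.

(`p ∼ P` means `P < p < P(1 + 𝓛⁻⁶⁸)`, `P = exp 𝓛⁹` (2.6); `𝔓 = ∑_{p∼P} p` (2.9);
`T = exp 𝓛^{1.1}`, p. 12.) **Status of the source: an unrefereed manuscript, a claimed result under
adjudication** (in-tree audit of v1: `Literature.NumberTheory.LFunctions.Zhang2022.not_ineq824`).

`Section5PrimeSums.lean` proves the lemma with the majorant `C P²𝓛⁻⁷⁷e^{−𝓛^{9/2}}` uniformly over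
the windows `P < p ≤ u`, `u ≤ P(1+𝓛⁻⁶⁸)` (`Zhang2022.lemma56`); `Section2FrakP.lean` proves (2.9),
`𝔓 = (1 + O(𝓛⁻⁶⁸))P²𝓛⁻⁷⁷` (`Zhang2022.frakP_bounds`). Here the two are combined into the
statement AS PRINTED: the sum over EXACTLY the primes `p ∼ P` (the open window) and the majorant
`C · 𝔓 · exp(−𝓛^{9/2})` — `lemma56_printed`. As in `Section5PrimeSums.lean`, the hypothesis
`1 < r` (implicit in every use of the lemma in the source, not printed) is carried explicitly, and
"`θ ≠ χ`" across moduli is inequality of the lifts to modulus `Dr`.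
-/

noncomputable section

open Complex

namespace Literature.NumberTheory.LFunctions.Zhang2022

open DirichletCharacter

/-- **Zhang 2022, Lemma 5.6, as printed.** There are `D₀ : ℕ` and `C > 0` such that for every
`D ≥ D₀`, every `χ ≠ χ₀` mod `D` with (A) `‖L(1, χ)‖ < (log D)⁻²⁰²²`, every
`1 < r < T = exp((log D)^{11/10})`, every primitive `θ` mod `r` with `θ ≠ χ` (as characters mod
`Dr`) and every real `t` with `|t| ≤ D`:
`‖∑_{p ∼ P} θ(p) p^{1+it}‖ ≤ C · 𝔓 · exp(−(log D)^{9/2})`, the sum over the primes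
`P < p < P(1 + (log D)⁻⁶⁸)`, `P = exp((log D)⁹)`, and `𝔓 = ∑_{p∼P} p` (`frakP D`).
[cite: Zhang2022LandauSiegel, Lemma 5.6, p. 11; (2.6), (2.9) p. 4]
[cite: MontgomeryVaughan2007, Theorems 6.9, 10.17, 11.3, 11.7, 12.10] [cite: Linnik1944]
[cite: Bombieri1987GrandCrible, §6 Théorème 14] -/
theorem lemma56_printed :
    ∃ D₀ : ℕ, ∃ C : ℝ, 0 < C ∧ ∀ (D : ℕ) [NeZero D], D₀ ≤ D → ∀ χ : DirichletCharacter ℂ D, χ ≠ 1 →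
      ‖χ.LFunction 1‖ < (Real.log D ^ 2022)⁻¹ →
      ∀ (r : ℕ) [NeZero r], 1 < r → (r : ℝ) < Real.exp (Real.log D ^ ((11 : ℝ) / 10)) →
      ∀ θ : DirichletCharacter ℂ r, θ.IsPrimitive →
        changeLevel (Nat.dvd_mul_left r D) θ ≠ changeLevel (Nat.dvd_mul_right D r) χ →
      ∀ t : ℝ, |t| ≤ D →
        ‖∑ p ∈ (Finset.Ioo ⌊Real.exp (Real.log D ^ 9)⌋₊
            ⌈Real.exp (Real.log D ^ 9) * (1 + (Real.log D ^ 68)⁻¹)⌉₊).filter Nat.Prime,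
            θ p * (p : ℂ) ^ (1 + t * I)‖ ≤
          C * frakP D * Real.exp (-(Real.log D ^ ((9 : ℝ) / 2))) := by
  obtain ⟨D₁, C, hC, H⟩ := lemma56
  obtain ⟨D₂, HP⟩ := frakP_bounds
  -- `D₃`: `log D ≥ 2`, so that `P·𝓛⁻⁶⁸ ≥ 1` and `3𝓛⁻⁶⁸ ≤ 1/2`
  obtain ⟨D₃, hD₃⟩ : ∃ D₃ : ℕ, ∀ D : ℕ, D₃ ≤ D → (2 : ℝ) ≤ Real.log D := by
    refine ⟨⌈Real.exp 2⌉₊ + 1, fun D hD => ?_⟩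
    have h1 : Real.exp 2 ≤ D := by
      have : (⌈Real.exp 2⌉₊ : ℝ) + 1 ≤ D := by exact_mod_cast hD
      linarith [Nat.le_ceil (Real.exp 2)]
    have hD0 : (0 : ℝ) < D := lt_of_lt_of_le (Real.exp_pos 2) h1
    rw [Real.le_log_iff_exp_le hD0]
    exact h1
  refine ⟨max D₁ (max D₂ D₃), 2 * C, by positivity,
    fun D _ hD χ hχ hA r _ hr1 hrT θ hprim hne t ht ↦ ?_⟩
  have hD₁ : D₁ ≤ D := le_trans (le_max_left _ _) hD
  have hD₂ : D₂ ≤ D := le_trans (le_trans (le_max_left _ _) (le_max_right _ _)) hD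
  have hL2 : 2 ≤ Real.log D := hD₃ D (le_trans (le_trans (le_max_right _ _) (le_max_right _ _)) hD)
  set L : ℝ := Real.log D with hLdef
  set P : ℝ := Real.exp (L ^ 9) with hPdef
  set P₁ : ℝ := P * (1 + (L ^ 68)⁻¹) with hP₁def
  have hL1 : 1 ≤ L := by linarith
  have hL0 : 0 < L := by linarith
  have hP0 : 0 < P := Real.exp_pos _
  have ha0 : 0 < (L ^ 68)⁻¹ := by positivity
  have ha6 : 3 * (L ^ 68)⁻¹ ≤ 1 / 2 := by
    rw [show 3 * (L ^ 68)⁻¹ = 3 / L ^ 68 by ring, div_le_div_iff₀ (by positivity) (by norm_num)]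
    have : (2 : ℝ) ^ 68 ≤ L ^ 68 := pow_le_pow_left₀ (by norm_num) hL2 68
    nlinarith
  have hP₁0 : 0 < P₁ := by positivity
  -- `P 𝓛⁻⁶⁸ ≥ 1`, i.e. `L⁶⁸ ≤ exp(L⁹)`
  have hPa : 1 ≤ P * (L ^ 68)⁻¹ := by
    rw [← div_eq_mul_inv, le_div_iff₀ (by positivity), one_mul, hPdef]
    have hLexp : L ≤ Real.exp L := by linarith [Real.add_one_le_exp L]
    calc L ^ 68 ≤ Real.exp L ^ 68 := pow_le_pow_left₀ hL0.le hLexp 68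
      _ = Real.exp (68 * L) := by rw [← Real.exp_nat_mul]; norm_num
      _ ≤ Real.exp (L ^ 9) := Real.exp_le_exp.2 (by
          have : L ^ 9 = L ^ 8 * L := by ring
          nlinarith [pow_le_pow_left₀ (by norm_num : (0:ℝ) ≤ 2) hL2 8])
  -- the largest integer `u < P₁`
  set U : ℕ := ⌈P₁⌉₊ - 1 with hUdef
  have hceil1 : 1 ≤ ⌈P₁⌉₊ := Nat.one_le_iff_ne_zero.2 (Nat.ceil_pos.2 hP₁0).ne'
  have hUreal : (U : ℝ) = ⌈P₁⌉₊ - 1 := by rw [hUdef, Nat.cast_sub hceil1, Nat.cast_one]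
  have hUlt : (U : ℝ) < P₁ := by rw [hUreal]; linarith [Nat.ceil_lt_add_one hP₁0.le]
  have hUge : P₁ - 1 ≤ U := by rw [hUreal]; linarith [Nat.le_ceil P₁]
  have hPU : P ≤ U := by
    have : P₁ - 1 = P + (P * (L ^ 68)⁻¹ - 1) := by rw [hP₁def]; ring
    linarith
  have hIoo : Finset.Ioo ⌊P⌋₊ ⌈P₁⌉₊ = Finset.Ioc ⌊P⌋₊ ⌊(U : ℝ)⌋₊ := by
    rw [Nat.floor_natCast, hUdef]; exact Ioo_eq_Ioc_sub_one _ _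
  have h := H D hD₁ χ hχ hA r hr1 hrT θ hprim hne t ht U hPU hUlt.le
  rw [← hIoo] at h
  -- `P²𝓛⁻⁷⁷ ≤ 2 𝔓`
  have hfr := HP D hD₂
  rw [abs_le] at hfr
  have hunit0 : 0 ≤ P ^ 2 * (L ^ 77)⁻¹ := by positivity
  have hfrakP : P ^ 2 * (L ^ 77)⁻¹ ≤ 2 * frakP D := by nlinarith [hfr.1]
  calc _ ≤ C * P ^ 2 * (L ^ 77)⁻¹ * Real.exp (-(L ^ ((9 : ℝ) / 2))) := h
    _ = C * (P ^ 2 * (L ^ 77)⁻¹) * Real.exp (-(L ^ ((9 : ℝ) / 2))) := by ring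
    _ ≤ C * (2 * frakP D) * Real.exp (-(L ^ ((9 : ℝ) / 2))) :=
        mul_le_mul_of_nonneg_right (mul_le_mul_of_nonneg_left hfrakP hC.le) (Real.exp_pos _).le
    _ = 2 * C * frakP D * Real.exp (-(L ^ ((9 : ℝ) / 2))) := by ring

end Literature.NumberTheory.LFunctions.Zhang2022

end
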